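import Mathlib
import HarnessLib
import Summits.AtomisticToContinuum.BoseEinsteinCondensation.Theorems.BECConjugateDominationInfraredMinimumUncertaintyWeakEulerLagrange

/-!
# Route `BECConjugateDomination` — crux `InfraredMinimumUncertainty` (stmt-AtomisticToContinuum-11784),
# line `fisher-gaussian-density-mode`: the ground-state representation of a positive minimiser

Registered sub-goal `groundStateRepresentation` (lead prover-line-stmt-AtomisticToContinuum-11784-0): for the real
finite-energy minimiser `Ψ` and every `C¹` periodic Bose-symmetric complex modulation `F`,
`Q(FΨ) − E₀ ‖FΨ‖² = ∫ |∇F|² |Ψ|²` (excitation energy of a modulated ground state = Dirichlet energy of the modulation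
under `μ = |Ψ|² dX`; phase twists `F = e^{iθ}` and amplitude modulations alike). Corollary of the weak
Euler–Lagrange identity (`Theorems.ImuWeakEulerLagrange.stub_weakEulerLagrange`) tested with `η = |F|² Ψ`.

Proof. Write `∂ = ∂_{i,k}` for the directional derivative along `Pi.single i (e_k)`. By the product
rule `∂(FΨ) = F ∂Ψ + Ψ ∂F`, and since `Ψ` (hence `∂Ψ`, `im_fderiv_eq_zero`) is real,
`|∂(FΨ)|² = |∂F|² |Ψ|² + Re(conj(∂η) ∂Ψ)` pointwise, where `η = conj(F) · (F Ψ) = |F|² Ψ` has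
`∂η = conj(F) ∂(FΨ) + F Ψ conj(∂F)` (`norm_sq_modulatedDeriv`); also `Re(conj(η) Ψ) = |FΨ|²`
(`re_conj_modulatedTest_mul`). Integrating over the cell (all integrands are continuous, the
periodised interaction being bounded, `ImuWeakEulerLagrange.exists_periodicInteraction_le`) and
inserting the weak Euler–Lagrange identity `∫ (Re ∑ conj(∂η)∂Ψ + W Re(conj(η)Ψ)) = E₀ ∫ Re(conj(η)Ψ)`
for the `C¹` periodic Bose-symmetric test function `η` gives
`Q(FΨ) = ∫ |∇F|²|Ψ|² + E₀ ∫ |FΨ|²` (`form_modulated_sub_eq`).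

References: standard ground-state transform / Bakry–Émery `Γ`-calculus; cf. [ReedSimonIV1978]
§XIII.12, [Fournais2020] (1.1)–(1.2) for the periodic problem.
-/

noncomputable section

open MeasureTheory Filter Set
open scoped ENNReal NNReal Topology ComplexConjugate BigOperators

namespace Summit.AtomisticToContinuum.BoseEinsteinCondensation.Theorems

open Literature.MathematicalPhysics.QuantumManyBody.BoseGas

namespace ImuGroundStateRepresentation

variable {N : ℕ} {L : ℝ} {v : ℝ → ℝ≥0∞} {Cw : ℝ≥0∞}

/-! ### Pointwise algebra -/

/-- Pointwise algebra behind the ground-state representation: for complex `a, f` and *real*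
`p, q` (the values of `∂F`, `F`, `Ψ`, `∂Ψ` at a point), `|f q + p a|² = |a|² |p|² + Re(conj(D) q)`
with `D = conj(f) (f q + p a) + f p conj(a)` (the value of `∂η`, `η = conj(F) (F Ψ)`). [folklore] -/
theorem norm_sq_modulatedDeriv (a f p q : ℂ) (hp : p.im = 0) (hq : q.im = 0) :
    ‖f * q + p * a‖ ^ 2 =
      ‖a‖ ^ 2 * ‖p‖ ^ 2 + (conj (conj f * (f * q + p * a) + f * p * conj a) * q).re := by
  simp only [Complex.sq_norm, Complex.normSq_apply, map_add, map_mul, Complex.conj_conj,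
    Complex.add_re, Complex.add_im, Complex.mul_re, Complex.mul_im, Complex.conj_re,
    Complex.conj_im, hp, hq]
  ring

/-- `Re(conj(conj(f) (f p)) p) = |f p|²`: the mass pairing of the test function
`η = conj(F) (F Ψ) = |F|² Ψ` with `Ψ` is `|F Ψ|²`. [folklore] -/
theorem re_conj_modulatedTest_mul (f p : ℂ) :
    (conj (conj f * (f * p)) * p).re = ‖f * p‖ ^ 2 := by
  simp only [Complex.sq_norm, Complex.normSq_apply, map_mul, Complex.conj_conj, Complex.mul_re,
    Complex.mul_im, Complex.conj_re, Complex.conj_im]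
  ring

/-- A real-valued (`Ψ = |Ψ|`) `C¹` amplitude has real directional derivatives:
`Im ∂Ψ = ∂(Im Ψ) = 0`. [folklore] -/
theorem im_fderiv_eq_zero (Ψ : PeriodicTrialState N L) (hreal : ∀ X, Ψ.ψ X = (‖Ψ.ψ X‖ : ℂ))
    (X w : Config N) : (fderiv ℝ Ψ.ψ X w).im = 0 := by
  have hd : DifferentiableAt ℝ Ψ.ψ X := (Ψ.contDiff.differentiable one_ne_zero) X
  have h1 : HasFDerivAt (fun Y => (Ψ.ψ Y).im) (Complex.imCLM.comp (fderiv ℝ Ψ.ψ X)) X :=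
    Complex.imCLM.hasFDerivAt.comp X hd.hasFDerivAt
  have h0 : (fun Y => (Ψ.ψ Y).im) = fun _ => (0 : ℝ) := by
    funext Y
    rw [hreal Y]
    exact Complex.ofReal_im _
  rw [h0] at h1
  have h2 : Complex.imCLM.comp (fderiv ℝ Ψ.ψ X) = 0 := h1.unique (hasFDerivAt_const (0 : ℝ) X)
  have h3 := DFunLike.congr_fun h2 w
  simpa using h3

/-! ### The identity, given the weak Euler–Lagrange equation for `η = |F|² Ψ` -/

/-- **Core of the ground-state representation.** If `Ψ` is a real-valued `C¹` periodic state,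
`F` a `C¹` modulation, the periodic interaction is bounded, and the weak Euler–Lagrange identity
holds for the test function `η = conj(F) (F Ψ) = |F|² Ψ` with eigenvalue parameter `E`, then
`∫ (|∇(FΨ)|² + W |FΨ|²) - E ∫ |FΨ|² = ∫ |∇F|² |Ψ|²`: expand `|∂(FΨ)|² = |F ∂Ψ + Ψ ∂F|²`
(`norm_sq_modulatedDeriv`, `Ψ` and `∂Ψ` real), split the integral of the continuous integrands on
the bounded cell, and substitute the Euler–Lagrange identity. [folklore] -/
theorem form_modulated_sub_eq (hvm : Measurable v) (hCw : Cw ≠ ⊤)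
    (hW : ∀ X : Config N, periodicInteraction v L X ≤ Cw) (Ψ : PeriodicTrialState N L)
    (hreal : ∀ X, Ψ.ψ X = (‖Ψ.ψ X‖ : ℂ)) {F : Config N → ℂ} (hF : ContDiff ℝ 1 F) (E : ℝ)
    (hEL : (∫ X in cellN N L,
        ((∑ i : Fin N, ∑ k : Fin 3,
            (conj (fderiv ℝ (fun Y => conj (F Y) * (F Y * Ψ.ψ Y)) X
                (Pi.single i (EuclideanSpace.single k (1 : ℝ)))) *
              fderiv ℝ Ψ.ψ X (Pi.single i (EuclideanSpace.single k (1 : ℝ)))).re) +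
          (periodicInteraction v L X).toReal * (conj (conj (F X) * (F X * Ψ.ψ X)) * Ψ.ψ X).re)) =
      E * ∫ X in cellN N L, (conj (conj (F X) * (F X * Ψ.ψ X)) * Ψ.ψ X).re) :
    (∫ X in cellN N L, ((∑ i : Fin N, ∑ k : Fin 3,
        ‖fderiv ℝ (fun Y : Config N => F Y * Ψ.ψ Y) X
          (Pi.single i (EuclideanSpace.single k (1 : ℝ)))‖ ^ 2) +
        (periodicInteraction v L X).toReal * ‖F X * Ψ.ψ X‖ ^ 2)) -
      E * (∫ X in cellN N L, ‖F X * Ψ.ψ X‖ ^ 2) =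
    ∫ X in cellN N L, (∑ i : Fin N, ∑ k : Fin 3,
      ‖fderiv ℝ F X (Pi.single i (EuclideanSpace.single k (1 : ℝ)))‖ ^ 2) * ‖Ψ.ψ X‖ ^ 2 := by
  have hFd := hF.differentiable one_ne_zero
  have hΨd := Ψ.contDiff.differentiable one_ne_zero
  -- the test function `η = conj(F) (F Ψ)` and the derivatives of `F Ψ` and `η`
  have hconj : ∀ X, HasFDerivAt (fun Y => conj (F Y))
      ((Complex.conjCLE : ℂ →L[ℝ] ℂ).comp (fderiv ℝ F X)) X :=
    fun X => Complex.conjCLE.hasFDerivAt.comp X (hFd X).hasFDerivAt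
  have hη : ContDiff ℝ 1 (fun Y => conj (F Y) * (F Y * Ψ.ψ Y)) :=
    (Complex.conjCLE.contDiff.comp hF).mul (hF.mul Ψ.contDiff)
  have hDΦ : ∀ X w, fderiv ℝ (fun Y => F Y * Ψ.ψ Y) X w =
      F X * fderiv ℝ Ψ.ψ X w + Ψ.ψ X * fderiv ℝ F X w := fun X w => by
    rw [fderiv_fun_mul (hFd X) (hΨd X), add_apply, smul_apply, smul_apply, smul_eq_mul, smul_eq_mul]
  have hDη : ∀ X w, fderiv ℝ (fun Y => conj (F Y) * (F Y * Ψ.ψ Y)) X w =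
      conj (F X) * (F X * fderiv ℝ Ψ.ψ X w + Ψ.ψ X * fderiv ℝ F X w) +
        F X * Ψ.ψ X * conj (fderiv ℝ F X w) := fun X w => by
    rw [fderiv_fun_mul (hconj X).differentiableAt ((hFd X).fun_mul (hΨd X)), (hconj X).fderiv,
      add_apply, smul_apply, smul_apply, smul_eq_mul, smul_eq_mul, hDΦ X w,
      ContinuousLinearMap.comp_apply]
    rfl
  -- pointwise identity of the integrands
  have him : ∀ X, (Ψ.ψ X).im = 0 := fun X => by
    rw [hreal X]
    exact Complex.ofReal_im _
  have hpt : ∀ X, (∑ i : Fin N, ∑ k : Fin 3,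
        ‖fderiv ℝ (fun Y : Config N => F Y * Ψ.ψ Y) X
          (Pi.single i (EuclideanSpace.single k (1 : ℝ)))‖ ^ 2) +
        (periodicInteraction v L X).toReal * ‖F X * Ψ.ψ X‖ ^ 2 =
      (∑ i : Fin N, ∑ k : Fin 3,
          ‖fderiv ℝ F X (Pi.single i (EuclideanSpace.single k (1 : ℝ)))‖ ^ 2) * ‖Ψ.ψ X‖ ^ 2 +
        ((∑ i : Fin N, ∑ k : Fin 3,
            (conj (fderiv ℝ (fun Y => conj (F Y) * (F Y * Ψ.ψ Y)) X
                (Pi.single i (EuclideanSpace.single k (1 : ℝ)))) *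
              fderiv ℝ Ψ.ψ X (Pi.single i (EuclideanSpace.single k (1 : ℝ)))).re) +
          (periodicInteraction v L X).toReal * (conj (conj (F X) * (F X * Ψ.ψ X)) * Ψ.ψ X).re) := by
    intro X
    have hterm : ∀ (i : Fin N) (k : Fin 3),
        ‖fderiv ℝ (fun Y : Config N => F Y * Ψ.ψ Y) X
            (Pi.single i (EuclideanSpace.single k (1 : ℝ)))‖ ^ 2 =
          ‖fderiv ℝ F X (Pi.single i (EuclideanSpace.single k (1 : ℝ)))‖ ^ 2 * ‖Ψ.ψ X‖ ^ 2 +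
            (conj (fderiv ℝ (fun Y => conj (F Y) * (F Y * Ψ.ψ Y)) X
                (Pi.single i (EuclideanSpace.single k (1 : ℝ)))) *
              fderiv ℝ Ψ.ψ X (Pi.single i (EuclideanSpace.single k (1 : ℝ)))).re := fun i k => by
      rw [hDΦ, hDη]
      exact norm_sq_modulatedDeriv _ _ _ _ (him X) (im_fderiv_eq_zero Ψ hreal X _)
    simp only [hterm, Finset.sum_add_distrib, Finset.sum_mul, re_conj_modulatedTest_mul]
    ring
  have hmass : ∀ X, (conj (conj (F X) * (F X * Ψ.ψ X)) * Ψ.ψ X).re = ‖F X * Ψ.ψ X‖ ^ 2 :=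
    fun X => re_conj_modulatedTest_mul _ _
  -- integrability on the bounded cell
  have h1 := hF.continuous_fderiv one_ne_zero
  have h2 := Ψ.contDiff.continuous_fderiv one_ne_zero
  have h3 := hη.continuous_fderiv one_ne_zero
  have hFc := hF.continuous
  have hΨc := Ψ.contDiff.continuous
  have iA : IntegrableOn (fun X => (∑ i : Fin N, ∑ k : Fin 3,
      ‖fderiv ℝ F X (Pi.single i (EuclideanSpace.single k (1 : ℝ)))‖ ^ 2) * ‖Ψ.ψ X‖ ^ 2)
      (cellN N L) :=
    integrableOn_cellN (by fun_prop) L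
  have iB : IntegrableOn (fun X => (∑ i : Fin N, ∑ k : Fin 3,
      (conj (fderiv ℝ (fun Y => conj (F Y) * (F Y * Ψ.ψ Y)) X
          (Pi.single i (EuclideanSpace.single k (1 : ℝ)))) *
        fderiv ℝ Ψ.ψ X (Pi.single i (EuclideanSpace.single k (1 : ℝ)))).re) +
      (periodicInteraction v L X).toReal * (conj (conj (F X) * (F X * Ψ.ψ X)) * Ψ.ψ X).re)
      (cellN N L) :=
    (integrableOn_cellN (by fun_prop) L).add
      (ImuWeakEulerLagrange.integrableOn_toReal_interaction_mul hvm hCw hW (by fun_prop))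
  have hsplit : (∫ X in cellN N L, ((∑ i : Fin N, ∑ k : Fin 3,
      ‖fderiv ℝ (fun Y : Config N => F Y * Ψ.ψ Y) X
        (Pi.single i (EuclideanSpace.single k (1 : ℝ)))‖ ^ 2) +
      (periodicInteraction v L X).toReal * ‖F X * Ψ.ψ X‖ ^ 2)) =
      (∫ X in cellN N L, (∑ i : Fin N, ∑ k : Fin 3,
        ‖fderiv ℝ F X (Pi.single i (EuclideanSpace.single k (1 : ℝ)))‖ ^ 2) * ‖Ψ.ψ X‖ ^ 2) +
      ∫ X in cellN N L, ((∑ i : Fin N, ∑ k : Fin 3,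
            (conj (fderiv ℝ (fun Y => conj (F Y) * (F Y * Ψ.ψ Y)) X
                (Pi.single i (EuclideanSpace.single k (1 : ℝ)))) *
              fderiv ℝ Ψ.ψ X (Pi.single i (EuclideanSpace.single k (1 : ℝ)))).re) +
          (periodicInteraction v L X).toReal * (conj (conj (F X) * (F X * Ψ.ψ X)) * Ψ.ψ X).re) := by
    rw [← integral_add iA iB]
    exact integral_congr_ae (ae_of_all _ hpt)
  have hM : (∫ X in cellN N L, (conj (conj (F X) * (F X * Ψ.ψ X)) * Ψ.ψ X).re) =
      ∫ X in cellN N L, ‖F X * Ψ.ψ X‖ ^ 2 :=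
    integral_congr_ae (ae_of_all _ hmass)
  rw [hsplit, hEL, hM]
  ring

/-! ### The registered sub-goal -/

/-- **Registered sub-goal `groundStateRepresentation`** of crux stmt-AtomisticToContinuum-11784 (line
`fisher-gaussian-density-mode`): the **ground-state representation of the positive minimiser**. For a
repulsive finite-range profile `v`, finite and `C²` as `x ↦ v(|x|)`, a periodic trial state `Ψ` of
`N = n + 1` bosons on the torus of side `L > 0` with `periodicEnergy v Ψ = E₀ := periodicGroundStateEnergy
v N L < ∞` and `Ψ = |Ψ|` pointwise, and every `C¹`, `Lℤ³`-periodic, Bose-symmetric modulation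
`F : (ℝ³)^N → ℂ`,
`∫_{cell^N} (∑_{i,k} |∂_{i,k}(FΨ)|² + W |FΨ|²) - E₀ ∫_{cell^N} |FΨ|² = ∫_{cell^N} |∇F|² |Ψ|²`,
`W = (∑_{i<j} v^per(xᵢ - xⱼ)).toReal`. Proof: the weak Euler–Lagrange identity
(`ImuWeakEulerLagrange.stub_weakEulerLagrange`) tested with `η = conj(F) (F Ψ) = |F|² Ψ`
(`C¹`, periodic, Bose-symmetric), inserted into the pointwise expansion of `|∂(FΨ)|²`
(`form_modulated_sub_eq`); the interaction is bounded by `ImuWeakEulerLagrange.exists_periodicInteraction_le`.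
[cite: Fournais2020, (1.1)–(1.2)] -/
theorem groundStateRepresentation :
    ∀ v : ℝ → ℝ≥0∞, IsRepulsiveFiniteRange v → (∀ r, v r ≠ ⊤) → ContDiff ℝ 2 (fun x : Space => (v ‖x‖).toReal) → (∃ Cₑ : ℝ, ∀ x : Space, ‖iteratedFDeriv ℝ 2 (fun x : Space => (v ‖x‖).toReal) x‖ ≤ Cₑ * Real.sqrt ((v ‖x‖).toReal)) → ∀ (n : ℕ) (L : ℝ), 0 < L → ∀ Ψ : PeriodicTrialState (n + 1) L, periodicEnergy v Ψ = periodicGroundStateEnergy v (n + 1) L → periodicEnergy v Ψ ≠ ⊤ → (∀ X, Ψ.ψ X = (‖Ψ.ψ X‖ : ℂ)) → ∀ F : Config (n + 1) → ℂ, ContDiff ℝ 1 F → (∀ (X : Config (n + 1)) (i : Fin (n + 1)) (k : Fin 3), F (X + Pi.single i (EuclideanSpace.single k L)) = F X) → (∀ (σ : Equiv.Perm (Fin (n + 1))) (X : Config (n + 1)), F (X ∘ σ) = F X) → (∫ X in cellN (n + 1) L, ((∑ i : Fin (n + 1), ∑ k : Fin 3, ‖fderiv ℝ (fun Y : Config (n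 + 1) => F Y * Ψ.ψ Y) X (Pi.single i (EuclideanSpace.single k (1 : ℝ)))‖ ^ 2) + (periodicInteraction v L X).toReal * ‖F X * Ψ.ψ X‖ ^ 2)) - (periodicGroundStateEnergy v (n + 1) L).toReal * (∫ X in cellN (n + 1) L, ‖F X * Ψ.ψ X‖ ^ 2) = ∫ X in cellN (n + 1) L, (∑ i : Fin (n + 1), ∑ k : Fin 3, ‖fderiv ℝ F X (Pi.single i (EuclideanSpace.single k (1 : ℝ)))‖ ^ 2) * ‖Ψ.ψ X‖ ^ 2 := by
  intro v hv htop hC2 hHess n L hL Ψ hmin hfin hreal F hF hFper hFsymm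
  obtain ⟨Cw, hCw, hW⟩ :=
    ImuWeakEulerLagrange.exists_periodicInteraction_le hv htop hC2.continuous hL (n + 1)
  have hη : ContDiff ℝ 1 (fun Y : Config (n + 1) => conj (F Y) * (F Y * Ψ.ψ Y)) :=
    (Complex.conjCLE.contDiff.comp hF).mul (hF.mul Ψ.contDiff)
  have hηper : ∀ (X : Config (n + 1)) (i : Fin (n + 1)) (k : Fin 3),
      (fun Y : Config (n + 1) => conj (F Y) * (F Y * Ψ.ψ Y))
          (X + Pi.single i (EuclideanSpace.single k L)) =
        (fun Y : Config (n + 1) => conj (F Y) * (F Y * Ψ.ψ Y)) X := fun X i k => by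
    simp only [hFper, Ψ.periodic]
  have hηsymm : ∀ (σ : Equiv.Perm (Fin (n + 1))) (X : Config (n + 1)),
      (fun Y : Config (n + 1) => conj (F Y) * (F Y * Ψ.ψ Y)) (X ∘ σ) =
        (fun Y : Config (n + 1) => conj (F Y) * (F Y * Ψ.ψ Y)) X := fun σ X => by
    simp only [hFsymm, Ψ.symm]
  have hEL := ImuWeakEulerLagrange.stub_weakEulerLagrange v hv htop hC2 hHess n L hL Ψ hmin hfin
    (fun Y : Config (n + 1) => conj (F Y) * (F Y * Ψ.ψ Y)) hη hηper hηsymm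
  exact form_modulated_sub_eq hv.1 hCw hW Ψ hreal hF _ hEL

end ImuGroundStateRepresentation

end Summit.AtomisticToContinuum.BoseEinsteinCondensation.Theorems

end
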